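import Summits.AtomisticToContinuum.Crystallization.Theses.ChessboardParticlePlanes
import Summits.AtomisticToContinuum.Crystallization.Theorems.CrystalLocalRigidityAssembly

/-!
# Route ChessboardParticlePlanes — item 6715 `Assembly`

Item `stmt-AtomisticToContinuum-6715` (assembly, rank 1) of route
`route-AtomisticToContinuum-ChessboardParticlePlanes`:

`LjPlaneChessboard → LjBilayerHcp → LjLaminarWindows → PeriodicWindows → LaminarPeriodisation →
 EnergeticGlue → CrysPeriodicBddBelow → CrysEnergyLimit → HullCriterion → Crystallization`
(conclusion: the sub-problem decl `_root_.Crystallization`, an `abbrev` for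
`Literature.MathematicalPhysics.StatisticalMechanics.Crystallization`).

PROOF (pure logic over the nine items plus the proved in-tree assembly lemma
`Literature.StatMech.crystallization_of_isLeast_tendsto_isCrystallizing`, stmt-0622):

* `LaminarPeriodisation` applied to `LjLaminarWindows` gives `LayerConfinedCompetitors`;
* `EnergeticGlue` applied to `LjPlaneChessboard`, `LjBilayerHcp`, the competitors and
  `CrysPeriodicBddBelow` gives `HcpPeriodicMinimiser`, i.e. some relaxed hcp `(a, h)` whose energy
  per particle is a least element of the range — in particular the periodic infimum is attained;
* `HullCriterion` applied to `PeriodicWindows` gives `IsCrystallizing lennardJones 3`;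
* with `CrysEnergyLimit` (`E(N)/N → ⨅_Q e(Q)`) the assembly lemma yields
  `Crystallization = HasPeriodicGroundStateEnergy ∧ IsCrystallizing` (`IsLeast.csInf_eq`).
-/

namespace Summit.AtomisticToContinuum.Crystallization.Theorems

open Summit.AtomisticToContinuum.Crystallization.Theses.ChessboardParticlePlanes

/-- **Item 6715 `Assembly`** (route `ChessboardParticlePlanes`, by name): the nine items
`LjPlaneChessboard`, `LjBilayerHcp`, `LjLaminarWindows`, `PeriodicWindows`,
`LaminarPeriodisation`, `EnergeticGlue`, `CrysPeriodicBddBelow`, `CrysEnergyLimit`,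
`HullCriterion` imply the sub-problem `Crystallization`.  Periodise the laminar windows
(`LaminarPeriodisation`), glue the energetic half into `HcpPeriodicMinimiser` (`EnergeticGlue`),
turn `PeriodicWindows` into `IsCrystallizing` (`HullCriterion`), and conclude with
`Literature.StatMech.crystallization_of_isLeast_tendsto_isCrystallizing` and `CrysEnergyLimit`.
[folklore] -/
theorem chessboardParticlePlanes_assembly_proof :
    Summit.AtomisticToContinuum.Crystallization.Theses.ChessboardParticlePlanes.Assembly := by
  unfold Summit.AtomisticToContinuum.Crystallization.Theses.ChessboardParticlePlanes.Assembly
  intro hRP h2D hLam hWin hPer hGlue hBdd hLim hHull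
  -- the energetic half: some relaxed hcp is a least element of the periodic energies
  obtain ⟨a, h, ha, hh, -, -, -, -, hLeast⟩ := hGlue hRP h2D (hPer hLam) hBdd
  exact Literature.StatMech.crystallization_of_isLeast_tendsto_isCrystallizing
    ⟨⟨_, hLeast⟩, hLim, hHull hWin⟩

end Summit.AtomisticToContinuum.Crystallization.Theorems
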